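import Summits.QuantumFields.YangMills.Theorems.UnitScaleTiltProp7HDsolAtRecordOfRowsTwoSlot
import Summits.QuantumFields.YangMills.Theorems.UnitScaleTiltProp7SectET3DeltaOneT3PInv
import Summits.QuantumFields.YangMills.Theorems.UnitScaleTiltProp7QkOntoOfRegPr
import Summits.QuantumFields.YangMills.Theorems.UnitScaleTiltProp7StubEXOfChartPiecesTwS
import Literature.MathematicalPhysics.QuantumFieldTheory.Balaban1983to89.T3PrintedMinimiserExistence
import HarnessLib

/-!
# [LIFT-THREAD 2 TWIN «D18» (EX namer ★w2-19200 g9 2026-08-29T17:22:48Z PEN ASSIGNMENT v1; px12 g11 SED LIST v0 2bd9ff01 row D18; ★★OWNER RULING №30; seat ym-routeR-w6 g11):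
# ✓`Prop7HDsolAtRecordOfRowsTwoSlotFamilyL` (px14 g3, LIFT-THREAD 1 twin D3ᴸ) BYTE-IDENTICAL except (a) the namespace (suffix `Lift`), (b) the token `Lift L i U₀ →` (the door's EXISTING
# opaque predicate binder `Lift`) inserted immediately after the last regularity guard of EVERY op-shaped N06-derived row — after `RegPr … (α L) U₀ →` in `hPos₁ hPosΔ hOpC h137 hTJ hOp349`,
# after `ρ ≤ α L →` in `norm_G prop4 norm_H₁` (uniform face: all 13 print rows carry the antecedent of record, hence every row derived from them does) — the at-record row `h128`
# and the CONCLUSION are UNCHANGED (they carry `Lift L i U₀ →` since LIFT-THREAD 1), (c) proof = v1's with `hLift` (already intro'd) passed at the nine row applications.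
# WHY (LOCATE d8153c1b, px12 g11): the displayed row `hPcol` (and likely `h349` + the kernel rows) is not inhabitable on stratum (c) for every `U₀ ∈ RegPr`; print proves the rows at
# backgrounds admitting the parallel lift, which the junction supplies by ✓`Prop7IrrLiftRowOfRecord.hIrrLift_of_record`; the S-files instantiate `Lift :=` the 6-line clause of record.]

# [LIFT-THREAD TWIN «D3ᴸ» (EX namer ★w2-19200 g7 2026-08-29T01:05:18Z (ii), seat ym3-torus-px14 g3): ✓`Prop7HDsolAtRecordOfRowsTwoSlotFamily` BYTE-IDENTICAL except (a) one new OPAQUE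
# binder `Lift : ∀ L (i : Idx L), GaugeField … → Prop` (the parallel-section lifting predicate of ★px14 g2's T1∕T2, text of record = ✓`Prop7HSplitDOfY1`'s), (b) ONE inserted antecedent
# `Lift L i U₀ →` right after `CloseAvg … V U₀ →` in the ROW `h128` AND in the CONCLUSION (`hΔsol`[Lift]), (c) proof = one extra `intro hLift` + pass-through to `h128`; so that ★px16's door
# (✓p680716∕✓p681225, `h128Δ` UNDER `Lift`) can REPLACE the displayed `h128Δ` once the whole chain Size19ᴸ∕T6ᴸ∕S7′ᴰᴸ…S16ᴰᴸ carries the antecedent.]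

# Route `UnitScaleTilt`, crux «MinimiserStabilityRegPr» (stmt-QuantumFields-19200, stub EX `stub_existenceMinimalOrbit`), route (α) — **JUNCTION `hΔsol` AT THE FAMILY LEVEL, TWO SLOTS (door B v3,
# «HDSOL-TWO-SLOT FAMILY»; EX namer ★w2-19200 g7 SLOT WORD 2026-08-28, cure of display defect №8 `hmult`, ★★OWNER RULING g28-№9 (a)): THE DISPLAYED ROW `hΔsol` OF THE EX DISPLAY OF RECORD S9″
# (✓`Prop7StubEXOfChartPiecesTwS9PCtrR`, p676326) VERBATIM — (136)+(140) for `ιA₁ + ι(H₁B̃)` of THE solution of (111) at the letters of record Δ₁ᴾ (`frakGfR∕H1f … (DeltaOnePJ …) U₀`, ✓p668391) —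
# FROM: the class `hPos₁` at Δ₁ᴾ (its (3.124) guards are THEOREMS, `0 ≤ a`), the class `hPosΔ` and the background-level rows `hOpCΔ h137Δ hTJ hOp349` AT THE OPERATOR SLOT `Δ^η + T_Jᴾ`
# (`DeltaEtaSlot … + TJSlotP …`, the honest Hessian of the chart action; ★px5 g2 ✓p676186 «OPROWS-ETA», slot-generic), print's (127)–(128) `h128Δ` for the solution (∃ μ; NO multiplier row `hmult`,
# NO (3.124) at the operator slot), `norm_G prop4 norm_H₁`, and the knit's windows** (member theorem ✓`Prop7HDsolAtRecordOfRowsTwoSlot.hΔsol_at_record_of_rows_twoSlot` at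
# `(ΔL, Δx) := (DeltaOnePJ, DeltaEtaSlot + TJSlotP)`, `MΔ L` EXPLICIT; twin of ✓`Prop7HDsolAtRecordOfRows127Family` (p670688), which it supersedes for S11).

Cell `ym3-torus`, width seat `ym-ust-19200-w2` (gen 7; EX knit lineage ∕ EX letter namer).  THEOREMS ONLY (0 `def`, 0 `sorry`); `--supports stmt-QuantumFields-19200 --as helper`, count-neutral.
YM₃ on T³ is a ladder rung (R3), not the Clay problem; nothing here claims the stub, the crux, d = 4 or the mass gap.

WHY TWO SLOTS (LOCATE «S11 SLOT WORD», HOME `ym-ust-19200-w2/g7/LOCATE-S11-SLOTWORD-w2g7.md`; print [Balaban1985Variational] pp.293–298, [Balaban1985BackgroundPropagators] pp.419–425): the letters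
`G₁ H₁ 𝔊` and (111) are print's at `Δ₁ = Pᵀ(Δ^η + T_J)P` (= `DeltaOnePJ`, where (3.124) and «RD*G₁DR = R» hold exactly), while (128) — criticality of the TRUE action on `ker Q` — is exact at the
honest Hessian `Δ^η + T_J` of the chart action (lit (84) with `Δ₁ = Δπ + T_J` at `Δπ := Δ̂^η`, ★px21 ✓p675218) and at no other slot; one opaque `W` (lit's `W80 … (Δπ := Δ̂^η)`) serves both.
THE ROWS (member texts = ✓`hΔsol_at_record_of_rows_twoSlot`'s binders under the family prefix): `hPos₁` (Δ₁ᴾ, positivity only), `hPosΔ` (`Δ^η + T_Jᴾ`, positivity only; [5] Thm 3.3 + (3.138)),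
`hOpCΔ` (tube term `Q_k†(QGQ*)⁻¹Q_kG x`, [5] Thm 3.3 n = 0), `h137Δ` ((137)'s block letter for `H₀`), `hTJ` (sup-row of `T_Jᴾ`, [5] (3.137)), `hOp349` («`DPD*` bounded»), `h128Δ` ((127)–(128), ∃ μ).
INHABITABILITY (★★OWNER RULING g27-№9 (3)): the four background-level rows are true at the zero field with `K`-uniform constants (N06); `hPos₁ hPosΔ` positivity only, inhabitable for `0 < a`
(S11 displays `ha : 0 < a L i`; this door keeps the weaker `ha0`); `h128Δ` is print's sentence about print's `A₁`, derivable from `hCrit93′ + hSplit′` (★px21 chain); `ha0 hWQ` numerics.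
Everything else this door reads is S9″'s own (prefix, `norm_G prop4 norm_H₁`, `hrα hr4 hr16`, `hWe hWε`).

WHAT IS PROVED (ns `…Theorems.Prop7HDsolAtRecordOfRowsTwoSlotFamily`).  ★★★`hΔsol_of_opRows_twoSlot_family` — S9″'s binder `hΔsol` quantifier for quantifier with
`MΔ L := (1 + 25·C₄ L·B₀ L²) + cC L·(1 + 25·C₄ L·B₀ L²) + c137 L·2 + kTJ L·(10 B₀ L)∕2 + 14·(10 B₀ L) + k349 L·(10 B₀ L)∕2 + 2·(10 B₀ L)`; the display's `hMΔ` numeric is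
✓`Prop7HDsolAtRecordOfRowsFamily.hMΔ_of_nonneg` (landed, `k139 := kTJ`).  HONEST SCOPE: by-name composition; the rows, `hPos₁ hPosΔ`, `norm_G prop4 norm_H₁` stay DISPLAYED; the opaque `Wf` untouched.

References: T. Bałaban, CMP 102 (1985) 277–309 [Balaban1985Variational] ((19) p.281, (79)–(84) p.290, (105)–(111) pp.293–294, Prop. 6 p.295, (127)–(140) pp.297–299); CMP 99 (1985) 389–434
[Balaban1985BackgroundPropagators] (Thm 3.3 p.399, Thm 3.11 p.416, (3.19) p.393, (3.49) p.399, (3.119)–(3.128) pp.419–421, (3.137)–(3.138) p.423, (3.153) p.426).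
-/

set_option autoImplicit false

noncomputable section

open scoped InnerProductSpace Matrix.Norms.L2Operator BigOperators

namespace Summit.QuantumFields.YangMills.Theorems.Prop7HDsolAtRecordOfRowsTwoSlotFamilyLLift

open Literature.MathematicalPhysics.QuantumFieldTheory.Balaban1983to89
open Literature.MathematicalPhysics.QuantumFieldTheory.Balaban1983to89.T3ContinuumYM3Torus
open Literature.MathematicalPhysics.QuantumFieldTheory.Balaban1983to89.T3UnitLawDensityEML (ℰp)
open Literature.MathematicalPhysics.QuantumFieldTheory.Balaban1983to89.T3TiltDescent (descendTo)
open Literature.MathematicalPhysics.QuantumFieldTheory.Balaban1983to89.T3Thm1Carrier (Idx)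
open Literature.MathematicalPhysics.QuantumFieldTheory.Balaban1983to89.T3PrintedRegularMinimiser (RegPr)
open Literature.MathematicalPhysics.QuantumFieldTheory.Balaban1983to89.T3PrintedMinimiserExistence (regPr_mono)
open Literature.MathematicalPhysics.QuantumFieldTheory.Balaban1983to89.T3SectALandauChart (CloseAvg eta bgUnits covGradT covCodiffCurlT covLapFormT)
open B9SectCLatticeCarrier (Bond)
open B9Eq311L2Pairing (WL2)
open B11Eq115Space (NegSize Space115 JetSup NegSup)
open B11Eq111FrakG (nabla115)
open B11Eq98CurrentSlot (Jcur)
open B11Eq103H1Complex (BondL2K funEquiv)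
open B13Contraction113 (QuadAnalytic)
open MatrixLog (mlog)
open Summit.QuantumFields.YangMills.Theorems.Prop7SectET3Transport (periodsT3 bgOfCfg bondEquiv)
open Summit.QuantumFields.YangMills.Theorems.Prop7SectET3HilbertLetters (W₂ frobEquiv toL2 toL2B DL2 DstarL2)
open Summit.QuantumFields.YangMills.Theorems.Prop7SectET3GaugeProjector (RS)
open Summit.QuantumFields.YangMills.Theorems.Prop7SectET3WilsonHessian (DeltaEta DeltaEtaSlot DeltaEtaSlot_apply)
open Summit.QuantumFields.YangMills.Theorems.Prop7SectET3CurvedPropagators (laplaceA Qk PosOnto GT KinvT H1f frakGfR)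
open Summit.QuantumFields.YangMills.Theorems.Prop7SectET3DeltaOnePInv (TJSlotP DeltaOnePJ DeltaOneP_kills_NS inner_DL2_DeltaOneP_eq_zero)
open Summit.QuantumFields.YangMills.Theorems.Prop7QkOntoOfRegPr (surjective_Qk_of_regPr)
open Summit.QuantumFields.YangMills.Theorems.Prop7StubEXOfChartPiecesTwS (windows_of_W)
open Summit.QuantumFields.YangMills.Theorems.Prop7StubEXOfChartPiecesTwL (windows_of_admissible three_le_memberL)
open Summit.QuantumFields.YangMills.Theorems.Prop7HDsolAtRecordOfRowsTwoSlot (hΔsol_at_record_of_rows_twoSlot)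

variable [hFL : ∀ F : T3Family, Fact (0 < (F.L : ℝ))] [hFη : ∀ (F : T3Family) (k : ℕ), Fact (0 < ((F.L : ℝ)⁻¹) ^ k)]
variable {α : ℕ → ℝ} {c₀ cB : ℕ → ℝ} [hc₀ : ∀ L : ℕ, Fact (0 < c₀ L)] [hcB : ∀ L : ℕ, Fact (0 < cB L)] {a : ∀ L : ℕ, Idx L → ℝ}
  {ef B₀ C₄ a₃ r cC c137 kTJ k349 : ℕ → ℝ}

/-- ★★★ **S9″'s ROW `hΔsol` AT THE LETTERS OF RECORD Δ₁ᴾ, FAMILY LEVEL, VERBATIM — FROM THE CLASSES `hPos₁` (Δ₁ᴾ) AND `hPosΔ` (`Δ^η + T_Jᴾ`), THE OPERATOR ROWS `hOpCΔ h137Δ hTJ hOp349` AT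
`Δ^η + T_Jᴾ`, PRINT's (128) `h128Δ` FOR THE SOLUTION, `norm_G prop4 norm_H₁` AND THE KNIT'S WINDOWS**, `MΔ L` explicit (✓`hΔsol_at_record_of_rows_twoSlot` at each member with
`(ΔL, Δx) := (DeltaOnePJ …, DeltaEtaSlot … + TJSlotP …)`, guards ✓`DeltaOneP_kills_NS`∕✓`inner_DL2_DeltaOneP_eq_zero` at `0 ≤ a`).
[cite: Balaban1985Variational, (127)–(136) pp.297–298, (140) p.299, (19)–(20) p.281, (79)–(84) p.290, (105)–(111) pp.293–294, Prop. 6 p.295; Balaban1985BackgroundPropagators, Thm 3.3 p.399, Thm 3.11 p.416, (3.19) p.393, (3.49) p.399, (3.124) p.420, (3.128) p.421, (3.137) p.423, (3.153) p.426] -/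
theorem hΔsol_of_opRows_twoSlot_familyL
    (Lift : ∀ (L : ℕ) (i : Idx L), GaugeField (i.1.1.P i.1.2.2) 0 (Matrix.specialUnitaryGroup (Fin 2) ℂ) → Prop) (hα : ∀ L, 1 < L → 0 < α L) (hef : ∀ L, 1 < L → 0 < ef L)
    (hWe : ∀ L : ℕ, 1 < L → 10 ^ 9 * (L : ℝ) ^ 2 * ef L ≤ 1) (hWε : ∀ L : ℕ, 1 < L → 10 ^ 12 * (L : ℝ) ^ 3 * α L ≤ 1)
    (hWQ : ∀ L : ℕ, 1 < L → 13 * 10 ^ 14 * (L : ℝ) ^ 3 * α L ≤ 1)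
    (hB₀ : ∀ L, 1 < L → 0 < B₀ L) (hC₄ : ∀ L, 1 < L → 0 < C₄ L) (ha0 : ∀ (L : ℕ) (i : Idx L), 0 ≤ a L i)
    (Wf : ∀ (L : ℕ) (i : Idx L) (U₀ : GaugeField (i.1.1.P i.1.2.2) 0 (Matrix.specialUnitaryGroup (Fin 2) ℂ)),
      Space115 (i.1.1.L : ℝ) (((i.1.1.L : ℝ)⁻¹) ^ (i.1.2.2 - i.1.2.1)) (fun _ : Bond 3 (periodsT3 i.1.1 i.1.2.2) => i.1.2.2 - i.1.2.1)
          (fun _ : Bond 3 (periodsT3 i.1.1 i.1.2.2) × Fin 3 => i.1.2.2 - i.1.2.1) (nabla115 (((i.1.1.L : ℝ)⁻¹) ^ (i.1.2.2 - i.1.2.1)) (bgOfCfg i.1.1 i.1.2.2 U₀)) →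
        NegSize (i.1.1.L : ℝ) (((i.1.1.L : ℝ)⁻¹) ^ (i.1.2.2 - i.1.2.1)) (fun _ : Bond 3 (periodsT3 i.1.1 i.1.2.2) => i.1.2.2 - i.1.2.1) 3 (Matrix (Fin 2) (Fin 2) ℂ))
    -- ROW `hPos₁` — the class at the LETTERS' slot Δ₁ᴾ ([5] Thm 3.11∕3.12 for `G₁`; positivity ONLY, onto is ✓`surjective_Qk_of_regPr`); with `0 ≤ a` the (3.124) guards of Δ₁ᴾ are THEOREMS
    (hPos₁ : ∀ (L : ℕ), 1 < L → ∀ (i : Idx L) (U₀ : GaugeField (i.1.1.P i.1.2.2) 0 (Matrix.specialUnitaryGroup (Fin 2) ℂ)), RegPr i.1.1 i.1.2.1 i.1.2.2 (α L) U₀ → Lift L i U₀ →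
      ∀ x : BondL2K ℂ 3 (periodsT3 i.1.1 i.1.2.2) (c₀ L) W₂, x ≠ 0 →
        0 < RCLike.re ⟪x, laplaceA i.1.1 i.1.2.1 i.1.2.2 i.2.2.le (c₀ L) (cB L) (a L i) (DeltaOnePJ i.1.1 i.1.2.1 i.1.2.2 i.2.2.le (c₀ L) (cB L) (a L i)) U₀ x⟫_ℂ)
    -- ROW `hPosΔ` — the class at the OPERATOR slot `Δ^η + T_Jᴾ` ([5] Thm 3.3 + (3.138) for the `G₀`-class propagator: `Δ^η + T_Jᴾ + DR_SD* + Q*aQ` POSITIVE on the regular class; N06;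
    -- positivity ONLY; INHABITABLE for `0 < a` — at `a = 0`, `U₀ = 𝟙` the constant 1-forms lie in `ker (Δ^η + DR_SD*)`)
    (hPosΔ : ∀ (L : ℕ), 1 < L → ∀ (i : Idx L) (U₀ : GaugeField (i.1.1.P i.1.2.2) 0 (Matrix.specialUnitaryGroup (Fin 2) ℂ)), RegPr i.1.1 i.1.2.1 i.1.2.2 (α L) U₀ → Lift L i U₀ →
      ∀ x : BondL2K ℂ 3 (periodsT3 i.1.1 i.1.2.2) (c₀ L) W₂, x ≠ 0 →
        0 < RCLike.re ⟪x, laplaceA i.1.1 i.1.2.1 i.1.2.2 i.2.2.le (c₀ L) (cB L) (a L i) ((DeltaEtaSlot i.1.1 i.1.2.1 i.1.2.2 (c₀ L) + TJSlotP i.1.1 i.1.2.1 i.1.2.2 i.2.2.le (c₀ L) (cB L) (a L i))) U₀ x⟫_ℂ)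
    (norm_G : ∀ (L : ℕ), 1 < L → ∀ (i : Idx L) (ρ : ℝ) (U₀ : GaugeField (i.1.1.P i.1.2.2) 0 (Matrix.specialUnitaryGroup (Fin 2) ℂ)),
      RegPr i.1.1 i.1.2.1 i.1.2.2 ρ U₀ → ρ ≤ α L → Lift L i U₀ → ∀ f, ‖frakGfR i.1.1 i.1.2.1 i.1.2.2 i.2.2.le (c₀ L) (cB L) (a L i) (DeltaOnePJ i.1.1 i.1.2.1 i.1.2.2 i.2.2.le (c₀ L) (cB L) (a L i)) U₀ f‖ ≤ B₀ L * ‖f‖)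
    (prop4 : ∀ (L : ℕ), 1 < L → ∀ (i : Idx L) (ρ : ℝ) (U₀ : GaugeField (i.1.1.P i.1.2.2) 0 (Matrix.specialUnitaryGroup (Fin 2) ℂ)),
      RegPr i.1.1 i.1.2.1 i.1.2.2 ρ U₀ → ρ ≤ α L → Lift L i U₀ → QuadAnalytic (Wf L i U₀) (C₄ L) (a₃ L))
    (norm_H₁ : ∀ (L : ℕ), 1 < L → ∀ (i : Idx L) (ρ : ℝ) (U₀ : GaugeField (i.1.1.P i.1.2.2) 0 (Matrix.specialUnitaryGroup (Fin 2) ℂ)),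
      RegPr i.1.1 i.1.2.1 i.1.2.2 ρ U₀ → ρ ≤ α L → Lift L i U₀ → ∀ b, ‖H1f i.1.1 i.1.2.1 i.1.2.2 i.2.2.le (c₀ L) (cB L) (a L i) (DeltaOnePJ i.1.1 i.1.2.1 i.1.2.2 i.2.2.le (c₀ L) (cB L) (a L i)) U₀ b‖ ≤ B₀ L * ‖b‖)
    (hrα : ∀ L : ℕ, 1 < L → 2 * B₀ L * α L ≤ r L) (hr4 : ∀ L : ℕ, 1 < L → 4 * r L ≤ a₃ L) (hr16 : ∀ L : ℕ, 1 < L → 16 * B₀ L * C₄ L * r L ≤ 1)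
    -- ROWS `hOpCΔ h137Δ` AT THE OPERATOR SLOT (★px5 texts): the tube term `Q_k†(QGQ*)⁻¹Q_kG x` ([5] Thm 3.3 (n = 0) × `(QGQ*)⁻¹` × `Q`; (133)'s `P₀*`-correction) and (137)'s block letter for `H₀`
    (hOpC : ∀ (L : ℕ), 1 < L → ∀ (i : Idx L) (U₀ : GaugeField (i.1.1.P i.1.2.2) 0 (Matrix.specialUnitaryGroup (Fin 2) ℂ)), RegPr i.1.1 i.1.2.1 i.1.2.2 (α L) U₀ → Lift L i U₀ →
      ∀ (x : BondL2K ℂ 3 (periodsT3 i.1.1 i.1.2.2) (c₀ L) W₂) (bd : PBond (i.1.1.P i.1.2.2) 0),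
        ‖(toL2 i.1.1 i.1.2.2 (c₀ L)).symm (LinearMap.adjoint (Qk i.1.1 i.1.2.1 i.1.2.2 i.2.2.le (c₀ L) (cB L) U₀) (KinvT i.1.1 i.1.2.1 i.1.2.2 i.2.2.le (c₀ L) (cB L) (a L i) ((DeltaEtaSlot i.1.1 i.1.2.1 i.1.2.2 (c₀ L) + TJSlotP i.1.1 i.1.2.1 i.1.2.2 i.2.2.le (c₀ L) (cB L) (a L i))) U₀ (Qk i.1.1 i.1.2.1 i.1.2.2 i.2.2.le (c₀ L) (cB L) U₀ (GT i.1.1 i.1.2.1 i.1.2.2 i.2.2.le (c₀ L) (cB L) (a L i) ((DeltaEtaSlot i.1.1 i.1.2.1 i.1.2.2 (c₀ L) + TJSlotP i.1.1 i.1.2.1 i.1.2.2 i.2.2.le (c₀ L) (cB L) (a L i))) U₀ x)))) bd‖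
          ≤ cC L * ‖(toL2 i.1.1 i.1.2.2 (c₀ L)).symm x‖)
    (h137 : ∀ (L : ℕ), 1 < L → ∀ (i : Idx L) (U₀ : GaugeField (i.1.1.P i.1.2.2) 0 (Matrix.specialUnitaryGroup (Fin 2) ℂ)), RegPr i.1.1 i.1.2.1 i.1.2.2 (α L) U₀ → Lift L i U₀ →
      ∀ (Y : PBond (i.1.1.P i.1.2.1) 0 → Matrix (Fin 2) (Fin 2) ℂ) (b : PBond (i.1.1.P i.1.2.2) 0),
        ‖(toL2 i.1.1 i.1.2.2 (c₀ L)).symm (LinearMap.adjoint (Qk i.1.1 i.1.2.1 i.1.2.2 i.2.2.le (c₀ L) (cB L) U₀) (KinvT i.1.1 i.1.2.1 i.1.2.2 i.2.2.le (c₀ L) (cB L) (a L i) ((DeltaEtaSlot i.1.1 i.1.2.1 i.1.2.2 (c₀ L) + TJSlotP i.1.1 i.1.2.1 i.1.2.2 i.2.2.le (c₀ L) (cB L) (a L i))) U₀ (toL2B i.1.1 i.1.2.1 (cB L) Y))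
            - LinearMap.adjoint (Qk i.1.1 i.1.2.1 i.1.2.2 i.2.2.le (c₀ L) (cB L) U₀) (((a L i : ℂ)) • toL2B i.1.1 i.1.2.1 (cB L) Y)) b‖ ≤ c137 L * ‖Y‖)
    -- ROW `hTJ` — the sup-row of print's J-term operator `T_Jᴾ` = `Δ^(2)` of (3.127)–(3.128)∕(3.136) ([5] (3.137) p.423: «|(Δ^(2)A)(b)| ≤ O(1)Mα₀(Lʲη)⁻²|A|», `K`-uniform, NO Landau
    -- condition; N06).  It is the slot-defect row `hOp139′` of ✓p676186 at `Δx := Δ^η + T_Jᴾ` (`Δ^η X − (Δ^η + T_Jᴾ)X = −T_JᴾX`).  INHABITABILITY: background-level operator; true at `X = 0`.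
    (hTJ : ∀ (L : ℕ), 1 < L → ∀ (i : Idx L) (U₀ : GaugeField (i.1.1.P i.1.2.2) 0 (Matrix.specialUnitaryGroup (Fin 2) ℂ)), RegPr i.1.1 i.1.2.1 i.1.2.2 (α L) U₀ → Lift L i U₀ →
      ∀ (X : PBond (i.1.1.P i.1.2.2) 0 → Matrix (Fin 2) (Fin 2) ℂ) (s : ℝ), (∀ bd, ‖X bd‖ ≤ s) →
        ∀ bd : PBond (i.1.1.P i.1.2.2) 0, ‖(toL2 i.1.1 i.1.2.2 (c₀ L)).symm (TJSlotP i.1.1 i.1.2.1 i.1.2.2 i.2.2.le (c₀ L) (cB L) (a L i) U₀ (toL2 i.1.1 i.1.2.2 (c₀ L) X)) bd‖ ≤ kTJ L * s)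
    (hOp349 : ∀ (L : ℕ), 1 < L → ∀ (i : Idx L) (U₀ : GaugeField (i.1.1.P i.1.2.2) 0 (Matrix.specialUnitaryGroup (Fin 2) ℂ)), RegPr i.1.1 i.1.2.1 i.1.2.2 (α L) U₀ → Lift L i U₀ →
      ∀ (X : PBond (i.1.1.P i.1.2.2) 0 → Matrix (Fin 2) (Fin 2) ℂ) (s : ℝ), (∀ bd, ‖X bd‖ ≤ s) → ∀ bd : PBond (i.1.1.P i.1.2.2) 0,
        ‖(toL2 i.1.1 i.1.2.2 (c₀ L)).symm (DL2 i.1.1 i.1.2.1 i.1.2.2 (c₀ L) U₀ (DstarL2 i.1.1 i.1.2.1 i.1.2.2 (c₀ L) U₀ (toL2 i.1.1 i.1.2.2 (c₀ L) X) - RS i.1.1 i.1.2.1 i.1.2.2 i.2.2.le (c₀ L) (cB L) U₀ (DstarL2 i.1.1 i.1.2.1 i.1.2.2 (c₀ L) U₀ (toL2 i.1.1 i.1.2.2 (c₀ L) X)))) bd‖ ≤ k349 L * s)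
    -- ROW `h128Δ` — PRINT's (127)–(128) FOR THE SOLUTION (family shape of ✓`hΔsol_at_record_of_rows_twoSlot`'s `(μ) h128`): the derivative of the TRUE chart action at the chart value
    -- `A′ = ιA₁ + ι(H₁B̃)` vanishes on `ker Q`, i.e. `(Δ^η + T_Jᴾ)(toL2 A′♭) + (Ĵ + Ŵ(A′)) ∈ range Q_k†` ([Balaban1985Variational] (127)–(128) p.297 «the functional (74), with the operator Δ
    -- instead of Δ_π»; the slot is the honest Hessian `Δ^η + T_Jᴾ` of the chart action — lit (84) ✓`B11Eq81ExpansionZpow.hasDerivAt_actionZ_chartRay_real` with `Δ₁ = Δπ + T_J`, ★px21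
    -- ✓`Prop7Rows84AtEtaSlot`).  DISPLAYED; supplier chain ★px21: ✓`Prop7Crit127OfCrit93Split.hCrit127_of_hCrit93_of_split127` (⟸ `hCrit93′ + hSplit′`) → «H128-OF-CRIT127» → lit (84) +
    -- ✓p675218 + the chart conjugacy (51).  INHABITABILITY: print's sentence about print's `A₁`; at the flat member with `J = 0`, `A₁ = 0`, `B̃ = 0`, `W(0) = 0` it reads `0 = Q_k† 0`.
    (h128 : ∀ (L : ℕ), 1 < L → ∀ (i : Idx L) (ε₁ : ℝ) (V : GaugeField (i.1.1.P i.1.2.1) 0 (Matrix.specialUnitaryGroup (Fin 2) ℂ))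
      (U₀ : GaugeField (i.1.1.P i.1.2.2) 0 (Matrix.specialUnitaryGroup (Fin 2) ℂ)), 0 < ε₁ → PlaqSmall ε₁ V →
      RegPr i.1.1 i.1.2.1 i.1.2.2 ((L : ℝ) ^ 3 * (3 * (L : ℝ)) * ε₁) U₀ → CloseAvg i.1.1 i.1.2.1 i.1.2.2 i.2.2.le ((L : ℝ) ^ 3 * ε₁) V U₀ → Lift L i U₀ → (L : ℝ) ^ 3 * (3 * (L : ℝ)) * ε₁ ≤ α L →
      ∀ A₁ : Space115 (i.1.1.L : ℝ) (((i.1.1.L : ℝ)⁻¹) ^ (i.1.2.2 - i.1.2.1)) (fun _ : Bond 3 (periodsT3 i.1.1 i.1.2.2) => i.1.2.2 - i.1.2.1)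
          (fun _ : Bond 3 (periodsT3 i.1.1 i.1.2.2) × Fin 3 => i.1.2.2 - i.1.2.1) (nabla115 (((i.1.1.L : ℝ)⁻¹) ^ (i.1.2.2 - i.1.2.1)) (bgOfCfg i.1.1 i.1.2.2 U₀)),
        ‖A₁‖ < r L →
        A₁ + frakGfR i.1.1 i.1.2.1 i.1.2.2 i.2.2.le (c₀ L) (cB L) (a L i) (DeltaOnePJ i.1.1 i.1.2.1 i.1.2.2 i.2.2.le (c₀ L) (cB L) (a L i)) U₀ (Jcur (bgOfCfg i.1.1 i.1.2.2 U₀)) + frakGfR i.1.1 i.1.2.1 i.1.2.2 i.2.2.le (c₀ L) (cB L) (a L i) (DeltaOnePJ i.1.1 i.1.2.1 i.1.2.2 i.2.2.le (c₀ L) (cB L) (a L i)) U₀ (Wf L i U₀ (A₁ + H1f i.1.1 i.1.2.1 i.1.2.2 i.2.2.le (c₀ L) (cB L) (a L i) (DeltaOnePJ i.1.1 i.1.2.1 i.1.2.2 i.2.2.le (c₀ L) (cB L) (a L i)) U₀ (fun c : PBond (i.1.1.P i.1.2.1) 0 =>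
          (-Complex.I) • mlog (((V c : Matrix.specialUnitaryGroup (Fin 2) ℂ) : Matrix (Fin 2) (Fin 2) ℂ)
            * star ((descendTo i.1.1 ℰp i.1.2.1 i.1.2.2 i.2.2.le U₀ c : Matrix.specialUnitaryGroup (Fin 2) ℂ) : Matrix (Fin 2) (Fin 2) ℂ))))) = 0 →
        ∃ μ : WL2 ℂ (fun _ : PBond (i.1.1.P i.1.2.1) 0 => cB L) W₂,
        (DeltaEtaSlot i.1.1 i.1.2.1 i.1.2.2 (c₀ L) + TJSlotP i.1.1 i.1.2.1 i.1.2.2 i.2.2.le (c₀ L) (cB L) (a L i)) U₀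
          (toL2 i.1.1 i.1.2.2 (c₀ L) ((fun b : PBond (i.1.1.P i.1.2.2) 0 => JetSup.equiv _ _ _ A₁ (bondEquiv i.1.1 i.1.2.2 b))
            + (fun b : PBond (i.1.1.P i.1.2.2) 0 => JetSup.equiv _ _ _ (H1f i.1.1 i.1.2.1 i.1.2.2 i.2.2.le (c₀ L) (cB L) (a L i) (DeltaOnePJ i.1.1 i.1.2.1 i.1.2.2 i.2.2.le (c₀ L) (cB L) (a L i)) U₀ (fun c : PBond (i.1.1.P i.1.2.1) 0 =>
            (-Complex.I) • mlog (((V c : Matrix.specialUnitaryGroup (Fin 2) ℂ) : Matrix (Fin 2) (Fin 2) ℂ)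
              * star ((descendTo i.1.1 ℰp i.1.2.1 i.1.2.2 i.2.2.le U₀ c : Matrix.specialUnitaryGroup (Fin 2) ℂ) : Matrix (Fin 2) (Fin 2) ℂ)))) (bondEquiv i.1.1 i.1.2.2 b))))
        + ((funEquiv frobEquiv (fun _ : Bond 3 (periodsT3 i.1.1 i.1.2.2) => c₀ L)).symm
          (NegSup.equiv _ _ (Jcur (L := (i.1.1.L : ℝ)) (η := ((i.1.1.L : ℝ)⁻¹) ^ (i.1.2.2 - i.1.2.1)) (lev₀ := fun _ : Bond 3 (periodsT3 i.1.1 i.1.2.2) => i.1.2.2 - i.1.2.1) (bgOfCfg i.1.1 i.1.2.2 U₀))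
            + NegSup.equiv _ _ (Wf L i U₀ (A₁ + H1f i.1.1 i.1.2.1 i.1.2.2 i.2.2.le (c₀ L) (cB L) (a L i) (DeltaOnePJ i.1.1 i.1.2.1 i.1.2.2 i.2.2.le (c₀ L) (cB L) (a L i)) U₀ (fun c : PBond (i.1.1.P i.1.2.1) 0 =>
            (-Complex.I) • mlog (((V c : Matrix.specialUnitaryGroup (Fin 2) ℂ) : Matrix (Fin 2) (Fin 2) ℂ)
              * star ((descendTo i.1.1 ℰp i.1.2.1 i.1.2.2 i.2.2.le U₀ c : Matrix.specialUnitaryGroup (Fin 2) ℂ) : Matrix (Fin 2) (Fin 2) ℂ)))))))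
          = LinearMap.adjoint (Qk i.1.1 i.1.2.1 i.1.2.2 i.2.2.le (c₀ L) (cB L) U₀) μ) :
    ∀ (L : ℕ), 1 < L → ∀ (i : Idx L) (ε₁ : ℝ) (V : GaugeField (i.1.1.P i.1.2.1) 0 (Matrix.specialUnitaryGroup (Fin 2) ℂ))
      (U₀ : GaugeField (i.1.1.P i.1.2.2) 0 (Matrix.specialUnitaryGroup (Fin 2) ℂ)), 0 < ε₁ → PlaqSmall ε₁ V →
      RegPr i.1.1 i.1.2.1 i.1.2.2 ((L : ℝ) ^ 3 * (3 * (L : ℝ)) * ε₁) U₀ → CloseAvg i.1.1 i.1.2.1 i.1.2.2 i.2.2.le ((L : ℝ) ^ 3 * ε₁) V U₀ → Lift L i U₀ → (L : ℝ) ^ 3 * (3 * (L : ℝ)) * ε₁ ≤ α L →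
      ∀ A₁ : Space115 (i.1.1.L : ℝ) (((i.1.1.L : ℝ)⁻¹) ^ (i.1.2.2 - i.1.2.1)) (fun _ : Bond 3 (periodsT3 i.1.1 i.1.2.2) => i.1.2.2 - i.1.2.1)
          (fun _ : Bond 3 (periodsT3 i.1.1 i.1.2.2) × Fin 3 => i.1.2.2 - i.1.2.1) (nabla115 (((i.1.1.L : ℝ)⁻¹) ^ (i.1.2.2 - i.1.2.1)) (bgOfCfg i.1.1 i.1.2.2 U₀)),
        ‖A₁‖ < r L →
        A₁ + frakGfR i.1.1 i.1.2.1 i.1.2.2 i.2.2.le (c₀ L) (cB L) (a L i) (DeltaOnePJ i.1.1 i.1.2.1 i.1.2.2 i.2.2.le (c₀ L) (cB L) (a L i)) U₀ (Jcur (bgOfCfg i.1.1 i.1.2.2 U₀)) + frakGfR i.1.1 i.1.2.1 i.1.2.2 i.2.2.le (c₀ L) (cB L) (a L i) (DeltaOnePJ i.1.1 i.1.2.1 i.1.2.2 i.2.2.le (c₀ L) (cB L) (a L i)) U₀ (Wf L i U₀ (A₁ + H1f i.1.1 i.1.2.1 i.1.2.2 i.2.2.le (c₀ L) (cB L) (a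 L i) (DeltaOnePJ i.1.1 i.1.2.1 i.1.2.2 i.2.2.le (c₀ L) (cB L) (a L i)) U₀ (fun c : PBond (i.1.1.P i.1.2.1) 0 =>
          (-Complex.I) • mlog (((V c : Matrix.specialUnitaryGroup (Fin 2) ℂ) : Matrix (Fin 2) (Fin 2) ℂ)
            * star ((descendTo i.1.1 ℰp i.1.2.1 i.1.2.2 i.2.2.le U₀ c : Matrix.specialUnitaryGroup (Fin 2) ℂ) : Matrix (Fin 2) (Fin 2) ℂ))))) = 0 →
        (∀ (μ : Fin (i.1.1.P i.1.2.2).d) (x : Site (i.1.1.P i.1.2.2) 0),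
            ‖covCodiffCurlT 1 (bgUnits i.1.1 i.1.2.2 U₀) ((fun b : PBond (i.1.1.P i.1.2.2) 0 => JetSup.equiv _ _ _ A₁ (bondEquiv i.1.1 i.1.2.2 b))
            + (fun b : PBond (i.1.1.P i.1.2.2) 0 => JetSup.equiv _ _ _ (H1f i.1.1 i.1.2.1 i.1.2.2 i.2.2.le (c₀ L) (cB L) (a L i) (DeltaOnePJ i.1.1 i.1.2.1 i.1.2.2 i.2.2.le (c₀ L) (cB L) (a L i)) U₀ (fun c : PBond (i.1.1.P i.1.2.1) 0 =>
          (-Complex.I) • mlog (((V c : Matrix.specialUnitaryGroup (Fin 2) ℂ) : Matrix (Fin 2) (Fin 2) ℂ)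
            * star ((descendTo i.1.1 ℰp i.1.2.1 i.1.2.2 i.2.2.le U₀ c : Matrix.specialUnitaryGroup (Fin 2) ℂ) : Matrix (Fin 2) (Fin 2) ℂ)))) (bondEquiv i.1.1 i.1.2.2 b))) μ x‖ ≤ ((1 + 25 * C₄ L * B₀ L ^ 2) + cC L * (1 + 25 * C₄ L * B₀ L ^ 2) + c137 L * 2 + kTJ L * (10 * B₀ L) / 2 + 14 * (10 * B₀ L) + k349 L * (10 * B₀ L) / 2 + 2 * (10 * B₀ L)) * ((L : ℝ) ^ 3 * (3 * (L : ℝ)) * ε₁) * eta i.1.1 i.1.2.1 i.1.2.2 ^ 2) ∧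
          (∀ (ν : Fin (i.1.1.P i.1.2.2).d) (x : Site (i.1.1.P i.1.2.2) 0),
            ‖covLapFormT 1 (bgUnits i.1.1 i.1.2.2 U₀) ((fun b : PBond (i.1.1.P i.1.2.2) 0 => JetSup.equiv _ _ _ A₁ (bondEquiv i.1.1 i.1.2.2 b))
            + (fun b : PBond (i.1.1.P i.1.2.2) 0 => JetSup.equiv _ _ _ (H1f i.1.1 i.1.2.1 i.1.2.2 i.2.2.le (c₀ L) (cB L) (a L i) (DeltaOnePJ i.1.1 i.1.2.1 i.1.2.2 i.2.2.le (c₀ L) (cB L) (a L i)) U₀ (fun c : PBond (i.1.1.P i.1.2.1) 0 =>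
          (-Complex.I) • mlog (((V c : Matrix.specialUnitaryGroup (Fin 2) ℂ) : Matrix (Fin 2) (Fin 2) ℂ)
            * star ((descendTo i.1.1 ℰp i.1.2.1 i.1.2.2 i.2.2.le U₀ c : Matrix.specialUnitaryGroup (Fin 2) ℂ) : Matrix (Fin 2) (Fin 2) ℂ)))) (bondEquiv i.1.1 i.1.2.2 b))) ν x‖ ≤ ((1 + 25 * C₄ L * B₀ L ^ 2) + cC L * (1 + 25 * C₄ L * B₀ L ^ 2) + c137 L * 2 + kTJ L * (10 * B₀ L) / 2 + 14 * (10 * B₀ L) + k349 L * (10 * B₀ L) / 2 + 2 * (10 * B₀ L)) * ((L : ℝ) ^ 3 * (3 * (L : ℝ)) * ε₁) * eta i.1.1 i.1.2.1 i.1.2.2 ^ 2) := by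
  intro L hL i ε₁ V U₀ hε₁ hV hreg hclose hLift hαe A₁ hA₁ hsol
  have hFL' : (i.1.1.L : ℝ) = (L : ℝ) := by exact_mod_cast i.2.1
  have hL1 : (1 : ℝ) ≤ (L : ℝ) := by exact_mod_cast hL.le
  have hL3 : (3 : ℝ) ≤ (L : ℝ) := by rw [← hFL']; exact three_le_memberL i
  obtain ⟨s3, -⟩ := windows_of_W hL3 (hα L hL).le (hef L hL).le (hWe L hL) (hWε L hL)
  obtain ⟨hwinL, -, hα16⟩ := windows_of_admissible hL1 hε₁.le hαe s3
  have hregα : RegPr i.1.1 i.1.2.1 i.1.2.2 (α L) U₀ := regPr_mono i.1.1 hαe hreg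
  have hWQ' : 13 * 10 ^ 14 * (i.1.1.L : ℝ) ^ 3 * α L ≤ 1 := by rw [hFL']; exact hWQ L hL
  have hpL : PosOnto i.1.1 i.1.2.1 i.1.2.2 i.2.2.le (c₀ L) (cB L) (a L i) (DeltaOnePJ i.1.1 i.1.2.1 i.1.2.2 i.2.2.le (c₀ L) (cB L) (a L i)) U₀ :=
    ⟨hPos₁ L hL i U₀ hregα hLift, surjective_Qk_of_regPr i.1.1 i.2.2.le i.2.2 (c₀ L) (cB L) hregα hWQ'⟩
  have hp : PosOnto i.1.1 i.1.2.1 i.1.2.2 i.2.2.le (c₀ L) (cB L) (a L i) (DeltaEtaSlot i.1.1 i.1.2.1 i.1.2.2 (c₀ L) + TJSlotP i.1.1 i.1.2.1 i.1.2.2 i.2.2.le (c₀ L) (cB L) (a L i)) U₀ :=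
    ⟨hPosΔ L hL i U₀ hregα hLift, surjective_Qk_of_regPr i.1.1 i.2.2.le i.2.2 (c₀ L) (cB L) hregα hWQ'⟩
  -- the slot-defect row of the junction at `Δx := Δ^η + T_Jᴾ` from `hTJ`: `Δ^η X − (Δ^η + T_Jᴾ) X = −T_Jᴾ X`
  have hOp139 : ∀ (X : PBond (i.1.1.P i.1.2.2) 0 → Matrix (Fin 2) (Fin 2) ℂ) (s : ℝ),
      RS i.1.1 i.1.2.1 i.1.2.2 i.2.2.le (c₀ L) (cB L) U₀ (DstarL2 i.1.1 i.1.2.1 i.1.2.2 (c₀ L) U₀ (toL2 i.1.1 i.1.2.2 (c₀ L) X)) = 0 → (∀ bd, ‖X bd‖ ≤ s) →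
      ∀ bd : PBond (i.1.1.P i.1.2.2) 0, ‖(toL2 i.1.1 i.1.2.2 (c₀ L)).symm (DeltaEta i.1.1 i.1.2.1 i.1.2.2 (c₀ L) U₀ (toL2 i.1.1 i.1.2.2 (c₀ L) X)
        - (DeltaEtaSlot i.1.1 i.1.2.1 i.1.2.2 (c₀ L) + TJSlotP i.1.1 i.1.2.1 i.1.2.2 i.2.2.le (c₀ L) (cB L) (a L i)) U₀ (toL2 i.1.1 i.1.2.2 (c₀ L) X)) bd‖ ≤ kTJ L * s := by
    intro X s _ hX bd
    rw [Pi.add_apply, LinearMap.add_apply, DeltaEtaSlot_apply, sub_add_cancel_left, map_neg, Pi.neg_apply, norm_neg]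
    exact hTJ L hL i U₀ hregα hLift X s hX bd
  have hreg' : RegPr i.1.1 i.1.2.1 i.1.2.2 ((i.1.1.L : ℝ) ^ 3 * (3 * (i.1.1.L : ℝ)) * ε₁) U₀ := by rw [hFL']; exact hreg
  have hclose' : CloseAvg i.1.1 i.1.2.1 i.1.2.2 i.2.2.le ((i.1.1.L : ℝ) ^ 3 * ε₁) V U₀ := by rw [hFL']; exact hclose
  have hwin : (i.1.1.L : ℝ) ^ 3 * ε₁ ≤ 1 / 2 := by rw [hFL']; exact hwinL
  have hρ1 : (i.1.1.L : ℝ) ^ 3 * (3 * (i.1.1.L : ℝ)) * ε₁ ≤ 1 := by rw [hFL']; linarith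
  have hB0 : 0 < B₀ L := hB₀ L hL
  have hρα : (i.1.1.L : ℝ) ^ 3 * (3 * (i.1.1.L : ℝ)) * ε₁ ≤ α L := by rw [hFL']; exact hαe
  have h1 : 2 * B₀ L * (i.1.1.L : ℝ) ^ 3 * (3 * (i.1.1.L : ℝ)) * ε₁ ≤ r L := by
    nlinarith [hrα L hL, mul_le_mul_of_nonneg_left hρα hB0.le]
  obtain ⟨μ, h128μ⟩ := h128 L hL i ε₁ V U₀ hε₁ hV hreg hclose hLift hαe A₁ hA₁ hsol
  have hmem := hΔsol_at_record_of_rows_twoSlot i.1.1 i.1.2.1 i.1.2.2 i.2.2.le U₀ V (Wf L i U₀) hB0 (hC₄ L hL) hε₁ hreg' hclose' hwin hρ1 hpL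
    (DeltaOneP_kills_NS _ (ha0 L i)) (inner_DL2_DeltaOneP_eq_zero _ (ha0 L i)) hp
    (norm_G L hL i _ U₀ hreg hαe hLift) (prop4 L hL i _ U₀ hreg hαe hLift) (norm_H₁ L hL i _ U₀ hreg hαe hLift) h1 (hr4 L hL) (hr16 L hL)
    (hOpC L hL i U₀ hregα hLift) (h137 L hL i U₀ hregα hLift) hOp139 (hOp349 L hL i U₀ hregα hLift) A₁ hA₁ hsol μ h128μ
  refine ⟨fun μ x => (hmem.1 μ x).trans_eq ?_, fun ν x => (hmem.2 ν x).trans_eq ?_⟩ <;> rw [hFL']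

end Summit.QuantumFields.YangMills.Theorems.Prop7HDsolAtRecordOfRowsTwoSlotFamilyLLift

end
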